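import Mathlib

/-!
# Crux `WordLengthQP` (stmt-ValiantsHypothesis-6623), line `positive-monoid-exits` —
stub `stub_inversionCost`: inverting a word costs at most 8 exits and 24 letters

A real affine elementary word of width 3 is a list of letters
`l = (i, j, c, o) : Fin 3 × Fin 3 × ℝ × Option σ` with matrix `E_ij(c)` (`o = none`) or
`E_ij(c · x_v)` (`o = some v`), i.e. `Matrix.transvection i j (C c * o.elim 1 X)`; the value of a
word is the product of its letter matrices, it is VALID if `i ≠ j` for every letter, and its EXITS
(from Lusztig's positive monoid) are the letters that are NOT (positive coefficient `c > 0` and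
adjacent, `|i - j| = 1`).

**Inversion is cheap.** For every valid word `w` there is a valid word `w'` with
`w'.prod * w.prod = 1`, at most `8` more exits and at most `24` more letters, namely
`w' = h ++ w^{rev,♭} ++ h` where

* `h` is the constant 12-letter word `(x₁(1) y₁(-1) x₁(1))² (x₂(1) y₂(-1) x₂(1))²` whose value is
  `H = diag(-1, 1, -1)` (`ic_hmat`) and which has exactly `4` exits (its four negative letters);
* `w^{rev,♭}` is `w` reversed with the sign of every FAR letter (`|i - j| = 2`) flipped; it has the
  same exits as `w` (far letters are exits for either sign, adjacent letters are untouched).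

The identity `H · w^{rev,♭} · H · w = 1` is the telescoping (`ic_telescope`) of the per-letter facts
`T H T = H` for an adjacent letter `T` (`ic_adj_mul_H_mul_adj`, i.e. `H T H = T⁻¹`) and
`E_ij(-a) H E_ij(a) = H` for a far letter (`ic_far_mul_H_mul_far`, `H` commutes with `E₀₂`, `E₂₀`),
together with `H² = 1`.

Design: the assembly `ic_assemble` is stated for an abstract letter matrix `mat`, exit predicate `p`,
flip `flip`, word `h` and matrix `H`, so that the registered signature is obtained by instantiation;
the matrix facts are over an arbitrary commutative ring.  References: elementary words for
polynomials are [BenOrCleve1992] (Thm 1); everything here is folklore linear algebra.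
-/

-- `Summit.ValiantsHypothesis.ValiantsHypothesis.…` is the tree's mandated single-conjunct layout
-- (Sub = Summit), so the duplicated namespace component is intended.
set_option linter.dupNamespace false

noncomputable section

namespace Summit.ValiantsHypothesis.ValiantsHypothesis.Cruxes.WordLengthQP.PositiveMonoidExits

/-! ## Per-letter facts for `H = diag(-1, 1, -1)` -/

/-- `H² = 1` for `H = diag(-1, 1, -1)`. [folklore] -/
private theorem ic_H_mul_H {R : Type*} [CommRing R] :
    Matrix.diagonal ![(-1 : R), 1, -1] * Matrix.diagonal ![(-1 : R), 1, -1] = 1 := by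
  ext i j
  fin_cases i <;> fin_cases j <;> simp

/-- For an ADJACENT transvection `T = E_ij(a)` (`|i - j| = 1`, any `a`), `T H T = H`,
i.e. `H T H = T⁻¹`. [folklore] -/
-- adapted from `kgt_adj_mul_S_mul_adj` (Theorems/ElementaryWordLengthWordLengthQPStubKappaGeTwo)
private theorem ic_adj_mul_H_mul_adj {R : Type*} [CommRing R] (i j : Fin 3)
    (hij : i.val + 1 = j.val ∨ j.val + 1 = i.val) (a : R) :
    Matrix.transvection i j a * Matrix.diagonal ![(-1 : R), 1, -1] * Matrix.transvection i j a =
      Matrix.diagonal ![(-1 : R), 1, -1] := by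
  fin_cases i <;> fin_cases j <;> simp at hij <;>
  · ext k l
    fin_cases k <;> fin_cases l <;>
      simp [Matrix.transvection, Matrix.mul_apply, Fin.sum_univ_three, Matrix.one_apply]

/-- For a FAR transvection `E_ij(a)` (`i ≠ j` not adjacent, i.e. `(i, j) ∈ {(0, 2), (2, 0)}`),
`E_ij(-a) H E_ij(a) = H` (`H` commutes with `E_ij(a)` since `H₀₀ = H₂₂`). [folklore] -/
private theorem ic_far_mul_H_mul_far {R : Type*} [CommRing R] (i j : Fin 3) (hij : i ≠ j)
    (hfar : ¬ (i.val + 1 = j.val ∨ j.val + 1 = i.val)) (a : R) :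
    Matrix.transvection i j (-a) * Matrix.diagonal ![(-1 : R), 1, -1] * Matrix.transvection i j a =
      Matrix.diagonal ![(-1 : R), 1, -1] := by
  fin_cases i <;> fin_cases j <;> simp at hij hfar <;>
  · ext k l
    fin_cases k <;> fin_cases l <;>
      simp [Matrix.transvection, Matrix.mul_apply, Fin.sum_univ_three, Matrix.one_apply]

/-- Telescoping in a monoid: if `g a * H * f a = H` for every `a ∈ w`, then
`(∏ (w.reverse.map g)) * H * (∏ (w.map f)) = H` (peel the innermost pair). [folklore] -/
private theorem ic_telescope {M : Type*} [Monoid M] {α : Type*} (H : M) (f g : α → M)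
    (w : List α) (h : ∀ a ∈ w, g a * H * f a = H) :
    (w.reverse.map g).prod * H * (w.map f).prod = H := by
  induction w with
  | nil => simp
  | cons a w ih =>
    have ha := h a (by simp)
    have ih' := ih (fun b hb => h b (by simp [hb]))
    simp only [List.reverse_cons, List.map_append, List.map_cons, List.map_nil, List.prod_append,
      List.prod_cons, List.prod_nil, mul_one]
    calc (w.reverse.map g).prod * g a * H * (f a * (w.map f).prod)
        = (w.reverse.map g).prod * (g a * H * f a) * (w.map f).prod := by simp only [mul_assoc]
      _ = H := by rw [ha, ih']

/-! ## The constant word `h` for `H` -/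

/-- `(x₁(1) y₁(-1) x₁(1))² (x₂(1) y₂(-1) x₂(1))² = diag(-1, 1, -1)` as a product of twelve
transvections (`x₁(1) y₁(-1) x₁(1) = !![0, 1, 0; -1, 0, 0; 0, 0, 1]` squares to `diag(-1, -1, 1)`,
`x₂(1) y₂(-1) x₂(1) = !![1, 0, 0; 0, 0, 1; 0, -1, 0]` squares to `diag(1, -1, -1)`). [folklore] -/
private theorem ic_hmat {R : Type*} [CommRing R] :
    Matrix.transvection (0 : Fin 3) 1 (1 : R) * (Matrix.transvection 1 0 (-1) *
    (Matrix.transvection 0 1 1 * (Matrix.transvection 0 1 1 * (Matrix.transvection 1 0 (-1) *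
    (Matrix.transvection 0 1 1 * (Matrix.transvection 1 2 1 * (Matrix.transvection 2 1 (-1) *
    (Matrix.transvection 1 2 1 * (Matrix.transvection 1 2 1 * (Matrix.transvection 2 1 (-1) *
    Matrix.transvection 1 2 1)))))))))) = Matrix.diagonal ![(-1 : R), 1, -1] := by
  have hA : Matrix.transvection (0 : Fin 3) 1 (1 : R) *
      (Matrix.transvection 1 0 (-1) * Matrix.transvection 0 1 1) = !![0, 1, 0; -1, 0, 0; 0, 0, 1] := by
    ext k l
    fin_cases k <;> fin_cases l <;>
      simp [Matrix.transvection, Matrix.mul_apply, Fin.sum_univ_three, Matrix.one_apply]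
  have hB : Matrix.transvection (1 : Fin 3) 2 (1 : R) *
      (Matrix.transvection 2 1 (-1) * Matrix.transvection 1 2 1) = !![1, 0, 0; 0, 0, 1; 0, -1, 0] := by
    ext k l
    fin_cases k <;> fin_cases l <;>
      simp [Matrix.transvection, Matrix.mul_apply, Fin.sum_univ_three, Matrix.one_apply]
  calc Matrix.transvection (0 : Fin 3) 1 (1 : R) * (Matrix.transvection 1 0 (-1) *
      (Matrix.transvection 0 1 1 * (Matrix.transvection 0 1 1 * (Matrix.transvection 1 0 (-1) *
      (Matrix.transvection 0 1 1 * (Matrix.transvection 1 2 1 * (Matrix.transvection 2 1 (-1) *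
      (Matrix.transvection 1 2 1 * (Matrix.transvection 1 2 1 * (Matrix.transvection 2 1 (-1) *
      Matrix.transvection 1 2 1))))))))))
      = (Matrix.transvection (0 : Fin 3) 1 (1 : R) *
          (Matrix.transvection 1 0 (-1) * Matrix.transvection 0 1 1)) *
        (Matrix.transvection (0 : Fin 3) 1 (1 : R) *
          (Matrix.transvection 1 0 (-1) * Matrix.transvection 0 1 1)) *
        ((Matrix.transvection (1 : Fin 3) 2 (1 : R) *
          (Matrix.transvection 2 1 (-1) * Matrix.transvection 1 2 1)) *
         (Matrix.transvection (1 : Fin 3) 2 (1 : R) *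
          (Matrix.transvection 2 1 (-1) * Matrix.transvection 1 2 1))) := by
        simp only [mul_assoc]
    _ = !![0, 1, 0; -1, 0, 0; 0, 0, 1] * !![0, 1, 0; -1, 0, 0; 0, 0, 1] *
        (!![1, 0, 0; 0, 0, 1; 0, -1, 0] * !![1, 0, 0; 0, 0, 1; 0, -1, 0]) := by rw [hA, hB]
    _ = Matrix.diagonal ![(-1 : R), 1, -1] := by
        ext k l
        fin_cases k <;> fin_cases l <;> simp [Matrix.mul_apply, Fin.sum_univ_three]

/-- The constant word `h = [x₁(1), y₁(-1), x₁(1), x₁(1), y₁(-1), x₁(1), x₂(1), y₂(-1), x₂(1),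
x₂(1), y₂(-1), x₂(1)]` has 12 letters, exactly 4 exits (its negative letters), is valid, and
computes `H = diag(-1, 1, -1)`. [folklore] -/
private theorem ic_hword {σ : Type} (h : List (Fin 3 × Fin 3 × ℝ × Option σ))
    (hdef : h = [((0 : Fin 3), (1 : Fin 3), (1 : ℝ), (none : Option σ)), (1, 0, -1, none),
      (0, 1, 1, none), (0, 1, 1, none), (1, 0, -1, none), (0, 1, 1, none),
      (1, 2, 1, none), (2, 1, -1, none), (1, 2, 1, none),
      (1, 2, 1, none), (2, 1, -1, none), (1, 2, 1, none)]) :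
    h.length = 12 ∧
    (h.filter (fun l => !decide (0 < l.2.2.1 ∧
      (l.1.val + 1 = l.2.1.val ∨ l.2.1.val + 1 = l.1.val)))).length = 4 ∧
    (∀ l ∈ h, l.1 ≠ l.2.1) ∧
    (h.map (fun l => Matrix.transvection l.1 l.2.1
      (MvPolynomial.C l.2.2.1 * l.2.2.2.elim 1 MvPolynomial.X))).prod =
      Matrix.diagonal ![(-1 : MvPolynomial σ ℝ), 1, -1] := by
  subst hdef
  refine ⟨rfl, ?_, ?_, ?_⟩
  · norm_num [List.filter_cons]
  · intro l hl
    fin_cases hl <;> simp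
  · simp only [List.map_cons, List.map_nil, List.prod_cons, List.prod_nil, mul_one, Option.elim_none,
      map_one, map_neg]
    exact ic_hmat

/-! ## Assembly -/

/-- Abstract assembly: if `h` is a valid 12-letter word with 4 exits computing `H`, `H² = 1`,
`mat (flip l) * H * mat l = H` for every valid letter `l`, and `flip` preserves the index pair and
the exit predicate `p`, then `h ++ (w.reverse.map flip) ++ h` inverts `w` with at most 8 more
exits and 24 more letters. [folklore] -/
private theorem ic_assemble {σ : Type}
    (mat : Fin 3 × Fin 3 × ℝ × Option σ → Matrix (Fin 3) (Fin 3) (MvPolynomial σ ℝ))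
    (p : Fin 3 × Fin 3 × ℝ × Option σ → Bool)
    (flip : Fin 3 × Fin 3 × ℝ × Option σ → Fin 3 × Fin 3 × ℝ × Option σ)
    (h : List (Fin 3 × Fin 3 × ℝ × Option σ)) (H : Matrix (Fin 3) (Fin 3) (MvPolynomial σ ℝ))
    (hh : h.length = 12 ∧ (h.filter p).length = 4 ∧ (∀ l ∈ h, l.1 ≠ l.2.1) ∧
      (h.map mat).prod = H)
    (hHH : H * H = 1) (hfm : ∀ l, l.1 ≠ l.2.1 → mat (flip l) * H * mat l = H)
    (hf : ∀ l, (flip l).1 = l.1 ∧ (flip l).2.1 = l.2.1 ∧ p (flip l) = p l)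
    (w : List (Fin 3 × Fin 3 × ℝ × Option σ)) (hw : ∀ l ∈ w, l.1 ≠ l.2.1) :
    ∃ w' : List (Fin 3 × Fin 3 × ℝ × Option σ), (∀ l ∈ w', l.1 ≠ l.2.1) ∧
      (w'.map mat).prod * (w.map mat).prod = 1 ∧
      (w'.filter p).length ≤ (w.filter p).length + 8 ∧ w'.length ≤ w.length + 24 := by
  obtain ⟨hlen, hex, hval, hprod⟩ := hh
  refine ⟨h ++ w.reverse.map flip ++ h, ?_, ?_, ?_, ?_⟩
  · intro l hl
    simp only [List.mem_append, List.mem_map, List.mem_reverse] at hl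
    rcases hl with (hl | ⟨a, ha, rfl⟩) | hl
    · exact hval l hl
    · rw [(hf a).1, (hf a).2.1]
      exact hw a ha
    · exact hval l hl
  · rw [List.map_append, List.map_append, List.prod_append, List.prod_append, hprod, List.map_map]
    have key := ic_telescope H mat (mat ∘ flip) w (fun a ha => hfm a (hw a ha))
    calc H * (w.reverse.map (mat ∘ flip)).prod * H * (w.map mat).prod
        = H * ((w.reverse.map (mat ∘ flip)).prod * H * (w.map mat).prod) := by
          simp only [mul_assoc]
      _ = 1 := by rw [key, hHH]
  · have hmid : ((w.reverse.map flip).filter p).length = (w.filter p).length := by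
      rw [List.filter_map, List.length_map]
      have hpf : p ∘ flip = p := funext fun l => (hf l).2.2
      rw [hpf, List.filter_reverse, List.length_reverse]
    simp only [List.filter_append, List.length_append, hex, hmid]
    omega
  · simp only [List.length_append, List.length_map, List.length_reverse, hlen]
    omega

/-! ## The stub -/

/-- **Inversion is cheap** (infrastructure stub `stub_inversionCost` of line
`positive-monoid-exits`): the inverse of the matrix of any valid real affine elementary word `w` of
width 3 is computed by a valid word `w'` (`w'.prod * w.prod = 1`) with at most 8 more exits and at
most 24 more letters — namely `w' = h ++ w^{rev,♭} ++ h` with `h` the constant 12-letter word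
`(x₁(1) y₁(-1) x₁(1))² (x₂(1) y₂(-1) x₂(1))²` for `H = diag(-1, 1, -1)` (4 exits) and `w^{rev,♭}` the
reversed word with the signs of its far letters flipped (`H E_ij(a) H = E_ij(-a)` for `|i - j| = 1`,
`= E_ij(a)` for `|i - j| = 2`).  Consequences: `κ(X⁻¹) ≤ κ(X) + 8`; a Ben-Or–Cleve commutator step
costs `2κ(X) + 2κ(Y) + 16` exits.  Elementary words for polynomials are Ben-Or–Cleve 1992.
[cite: BenOrCleve1992, Thm 1] -/
theorem stub_inversionCost {σ : Type} (w : List (Fin 3 × Fin 3 × ℝ × Option σ))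
    (hw : ∀ l ∈ w, l.1 ≠ l.2.1) :
    ∃ w' : List (Fin 3 × Fin 3 × ℝ × Option σ), (∀ l ∈ w', l.1 ≠ l.2.1) ∧
      (w'.map (fun l => Matrix.transvection l.1 l.2.1
        (MvPolynomial.C l.2.2.1 * l.2.2.2.elim 1 MvPolynomial.X))).prod *
      (w.map (fun l => Matrix.transvection l.1 l.2.1
        (MvPolynomial.C l.2.2.1 * l.2.2.2.elim 1 MvPolynomial.X))).prod = 1 ∧
      (w'.filter (fun l => !decide (0 < l.2.2.1 ∧
          (l.1.val + 1 = l.2.1.val ∨ l.2.1.val + 1 = l.1.val)))).length ≤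
        (w.filter (fun l => !decide (0 < l.2.2.1 ∧
          (l.1.val + 1 = l.2.1.val ∨ l.2.1.val + 1 = l.1.val)))).length + 8 ∧
      w'.length ≤ w.length + 24 := by
  refine ic_assemble _ _
    (fun l => if l.1.val + 1 = l.2.1.val ∨ l.2.1.val + 1 = l.1.val then l
      else (l.1, l.2.1, -l.2.2.1, l.2.2.2)) _ _ (ic_hword _ rfl) ic_H_mul_H ?_ ?_ w hw
  · rintro ⟨i, j, c, o⟩ hij
    dsimp only at hij ⊢
    split_ifs with hadj
    · exact ic_adj_mul_H_mul_adj i j hadj _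
    · dsimp only
      rw [map_neg, neg_mul]
      exact ic_far_mul_H_mul_far i j hij hadj _
  · rintro ⟨i, j, c, o⟩
    dsimp only
    split_ifs with hadj
    · exact ⟨rfl, rfl, rfl⟩
    · simp [hadj]

end Summit.ValiantsHypothesis.ValiantsHypothesis.Cruxes.WordLengthQP.PositiveMonoidExits

end
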